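import Summits.QuantumFields.YangMills.Theorems.BalabanUVNodesN07KLNOfLocalityRows
import Summits.QuantumFields.YangMills.Theorems.BalabanUVNodesN07FramedLettersOfThm312313
import HarnessLib

/-!
# hand-KLC's §5 DOOR FOR A DATUM FAMILY, ROWS EDITION — ✓`prop4UniformPrAtRecord_node00_of_prop5Clause_pr_param` (datum `𝔥` and window constant `c𝔥` binders, frame debts
# displayed) with (i) the (KL-N)ᵖʳ group DISCHARGED from {W2} ∧ {W3} (▶ PT-A g12's ✓`…N07KLNOfLocalityRows` §4) and (ii) ALL THREE propagator letter groups DISCHARGED from ONE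
# displayed (3.133) pair of `H₁^{pr}(U₀)` and the locality rows of `Δπ(U₀; G′, Q′)` — the family twin of `…KLCPrAtHierFrameRows`

Cell `pub-ymgap` ∕ `ym-nodeO-ideate`, porter lineage `ymgap-nodeO-port-PTB-1` (gen 12); ★★★ director-ym g24 №655 next-on-arrival (i).  `--kind proof --supports stmt-QuantumFields-27238
--as helper`; count-neutral; NEW basename; ✓`…KLCPrAtHierFrameParam` §1 and ▶ PT-A's ✓`…N07KLNOfLocalityRows` NOT edited.  [B7] = [Balaban1985Averaging]; [B9] =
[Balaban1985BackgroundPropagators]; [B11] = [Balaban1985Variational]; [4] = [Balaban1984PropagatorsII].  Print: [B11] (87)–(88) p. 291 «Δ_π H = (Δ_U + DRD*)H … applying (3.132),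
(55), (73)»; [B9] Thm 3.12 (3.133) p. 422; [4] (2.61) p. 234.

WHAT IS PROVED (0 def, 0 sorry, axioms standard; ns `Summit.QuantumFields.YangMills.Theorems.KExpOfRecordPr`; node-00 `∀ x, x ∈ Ω_k`, `0 < k ≤ m + K`; ANY datum family
`𝔥 K k U₀ : FrameDatum (F.P K) N k U₀`, its debts (hdom)∕(hnear)∕(hmap)∕(hderiv) and `c𝔥 ∈ [0, 10¹⁰]` displayed as in the door; `C₂ := (6.4·10¹²·c𝔥 + 2.56·10¹⁶)·L·N`):
* §1 `prop4UniformPrAtRecord_node00_of_prop5Clause_pr_param_of_localityRows` — the door with the six (KL-N)ᵖʳ binders OBTAINED from ✓`klNPr_of_localityRows_of_entryBounds`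
  ({W2} `h0 ∕ h1` at `(B₀, ρ)`; {W3} `hS` (L) ∕ `hR` (R) at `(s₀, s₁; C_π, σ)`); `N₁ := C_π B₀ d(2(1+1∕m))^d · d(2(1+1∕m))^d`, `Θ′ := (L^d)^k · N₁`, `m := min σ ρ ∕ 2`.
  ★★★ `prop4UniformPrAtRecord_node00_of_prop5Clause_pr_param_of_entryRows` — the door with (ℓa-H)ᵖʳ (✓`prop4LetterHPrAtRecord_of_entryBounds`, `b := B₀ · d(2(1+1∕ρ))^d`), (KL-H)ᵖʳ
  (✓`klH_of_entryBounds`, `Θ_H = Θ_H^w := (L^d)^k · b`) AND (KL-N)ᵖʳ ALL DISCHARGED from the ONE pair `h0 ∕ h1` and {W3}; REMAINING displayed: `hpos`∕`hQ`, the four frame debts, {W2},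
  {W3}, the (157) clause `h157` of `B7.Prop5Printed (kexpOfRecordPr F N 𝔥)` with `r + r ≤ α₁` and the window `hq`, `‖J‖ ≤ nJ`, print's (14) `hreg`, `∀ x, x ∈ Ω_k`.
The record's two inhabitants (SL `hierFrameDatumOfRecord`, GL `hierFrameGLDatumOfRecord`, no frame debt) are in `…KLCPrAtHierFrameRows`.

HONEST FRAMING.  Glue BY NAME (two `obtain`s, one `exact`); {W2}∕{W3} DISPLAYED, INHABITED NOWHERE — nothing of [B9] Thm 3.12, [B11] (72)–(73)∕(86)–(89)∕Prop. 4, [B7] Prop. 5 is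
proved here; `Θ_H`, `Θ′` NOT k-free; K0ᴬ ⟨stmt-QuantumFields-27238⟩ NOT closed (0∕2); ⟨27931⟩ CLOSED·IMPLICATION-ONLY; NODE O 0∕1; COUNT 8∕28 · K 1∕4 UNMOVED; one finite `𝕋⁴_{L^K}`
programme at fixed ε — NOT continuum ∕ ℝ⁴ ∕ OS ∕ Clay; **the Yang–Mills mass gap (Clay) is NOT proved by any of this.**  No `sorry`, `instance`, `notation`, `set_option`; standard axioms.
-/

noncomputable section

open scoped Matrix Matrix.Norms.L2Operator InnerProductSpace ComplexConjugate BigOperators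
open Classical

namespace Summit.QuantumFields.YangMills.Theorems.KExpOfRecordPr

open Literature.MathematicalPhysics.QuantumFieldTheory.Balaban1983to89
open Literature.MathematicalPhysics.QuantumFieldTheory.Balaban1983to89.Node00
open Summit.QuantumFields.YangMills.Theorems.KExpOfRecord (KRecIdx kexpOfRecord)
open T4Continuum BlockAveraging
open B10Eq42TorusConstraint (bondsIn)
open B10Eq38TorusDomains (toFine)
open B11Eq103H1Complex (SiteL2K)
open B9SectCLatticeCarrier (Bond)
open B11Eq115Space (NegSup NegSize JetSup levWeight levWeight_apply)
open B11Eq90Transpose (single115)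
open B11Eq90V0primeCurrent (flat115)
open B11Eq111FrakG (nabla115)
open B15AveragingHolomorphic (iterMh)
open Summit.QuantumFields.YangMills.BalabanUVNodes.N07Prop4LetterHOfThm312 (blkOfBond)
open Summit.QuantumFields.YangMills.BalabanUVNodes.N07KernelEntriesOfRecord (entry0 entry1 nColOp klH_of_entryBounds)
open Summit.QuantumFields.YangMills.BalabanUVNodes.N07FramedLettersOfThm312313 (prop4LetterHPrAtRecord_of_entryBounds)
open Summit.QuantumFields.YangMills.BalabanUVNodes.N07KLNOfLocalityRows (klNPr_of_localityRows_of_entryBounds blockRow0 blockRow1)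

variable (F : T4Family) (N : ℕ) [NeZero N]

/-! ## §1  hand-KLC's §5 door for a datum FAMILY `𝔥` (window constant `c𝔥` a binder): (KL-N)ᵖʳ ⇐ {W2} ∧ {W3}; then ALL THREE letter groups ⇐ ONE (3.133) pair ∧ {W3} -/

section Family

variable (𝔥 : ∀ (K k : ℕ) (U₀ : GaugeField (F.P K) 0 (SU N)), FrameDatum (F.P K) N k U₀)
variable (K k : ℕ) (Ω : ℕ → Set (Site (F.P K) 0)) (U₀ : GaugeField (F.P K) 0 (SU N))
variable [Fact (0 < (F.L : ℝ))] [Fact (0 < (F.P K).eta k)] [Fact (0 < c0Rec F K k)] [Fact (∀ c, 0 < wBRec F K k c)]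

/-- ★★ **hand-KLC's §5 DOOR (datum family `𝔥`, window constant `c𝔥 ∈ [0, 10¹⁰]` a binder) WITH THE (KL-N)ᵖʳ GROUP DISCHARGED FROM {W2} ∧ {W3}** — the six
(KL-N)ᵖʳ binders `hk′0 ∕ hNk ∕ hΘ′0 ∕ hΘ′ ∕ hN₁0 ∕ hN₁` of ✓`prop4UniformPrAtRecord_node00_of_prop5Clause_pr_param` are OBTAINED from ▶ PT-A's ✓`klNPr_of_localityRows_of_entryBounds`
({W2} := the (3.133) entry rows `h0 ∕ h1` of `H₁^{pr}(U₀)` at `(B₀, ρ)`; {W3} := the locality rows `hS` (L) ∕ `hR` (R) of `Δπ(U₀; G′, Q′)`), at `hk′ := ‖nColOp Δπ H₁^{pr} y b′‖`,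
`N₁ := C_π B₀ d(2(1+1∕m))^d · d(2(1+1∕m))^d`, `Θ′ := (L^d)^k · N₁`, `m := min σ ρ ∕ 2`; every other displayed letter VERBATIM (`hpos`∕`hQ`, (hdom)∕(hnear)∕(hmap)∕(hderiv), (ℓa-H)ᵖʳ `hH`,
(KL-H)ᵖʳ, the (157) clause `h157` with `r + r ≤ α₁` and the window `hq`, `‖J‖ ≤ nJ`, print's (14) `hreg`, `∀ x, x ∈ Ω_k`).  Glue BY NAME; nothing of [B7]∕[B9]∕[B11] proved.
[cite: Balaban1985Variational, Prop. 4 (97)–(98) pp.292–293, (72)–(73) p.289, (86)–(89) p.291, (130) p.298; Balaban1985Averaging, Proposition 5 (157) p.42; Balaban1985BackgroundPropagators, Thm 3.12 (3.132)–(3.133) p.422; Balaban1984PropagatorsII, (2.61) p.234] -/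
theorem prop4UniformPrAtRecord_node00_of_prop5Clause_pr_param_of_localityRows (levB : PBond (F.P K) k → ℕ) (a : ℝ)
    (hpos : ∀ x, x ≠ 0 → 0 < RCLike.re ⟪x, laplaceAOfRecord F N k U₀ (QprOfRecord F N k U₀ (𝔥 K k U₀)) (QprimeOfRecord F N k U₀) a x⟫_ℂ)
    (hQ : Function.Surjective (QprOfRecord F N k U₀ (𝔥 K k U₀)))
    (Gp : SiteL2K ℂ (F.P K).d (fun _ => (F.P K).sitesPerDir 0) (c0Rec F K k) (WRec N) →ₗ[ℂ]
      SiteL2K ℂ (F.P K).d (fun _ => (F.P K).sitesPerDir 0) (c0Rec F K k) (WRec N))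
    {b α nJ : ℝ} (hkpos : 0 < k) (hkm : k ≤ (F.P K).m + (F.P K).K) (hb : 0 ≤ b) (hΩ : ∀ x, x ∈ Ω k) (hαpos : 0 < α) (hα : α * (11000000 * N) ≤ 1)
    (hreg : ∀ j, j < k → PlaqSmall (α * ((F.L : ℝ) ^ j * (F.P K).eta k) ^ 2) (Averaging.iter (avOfRecord F N K) j U₀))
    {c𝔥 : ℝ} (hc0 : 0 ≤ c𝔥) (hc : c𝔥 ≤ 10000000000)
    (hdom : ∀ Y : PBond (F.P K) 0 → Matrix (Fin N) (Fin N) ℂ, (∀ b, (Y b).trace = 0) → (F.L : ℝ) ^ k * ‖Y‖ < 1 / (25000000000 * (F.L : ℝ) * N) →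
      expOver U₀ Y ∈ (𝔥 K k U₀).dom)
    (hnear : ∀ Y : PBond (F.P K) 0 → Matrix (Fin N) (Fin N) ℂ, (∀ b, (Y b).trace = 0) → (F.L : ℝ) ^ k * ‖Y‖ < 1 / (25000000000 * (F.L : ℝ) * N) →
      ∀ y : Site (F.P K) k, ‖(𝔥 K k U₀).map (expOver U₀ Y) y - 1‖ ≤ c𝔥 * ((F.L : ℝ) ^ k * ‖Y‖) ∧ ‖(𝔥 K k U₀).inv (expOver U₀ Y) y - 1‖ ≤ c𝔥 * ((F.L : ℝ) ^ k * ‖Y‖))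
    (hmap : ∀ Y : Set (Site (F.P K) 0), (∀ i, i < k → ∀ s : Site (F.P K) i, toFine i s ∈ Y ↔ toFine (i + 1) (blockOf s) ∈ Y) →
      ∀ V V' : PBond (F.P K) 0 → Matrix (Fin N) (Fin N) ℂ, (∀ b : PBond (F.P K) 0, b ∈ bondsIn 0 Y → V b = V' b) →
      ∀ y : Site (F.P K) k, toFine k y ∈ Y → (𝔥 K k U₀).map V y = (𝔥 K k U₀).map V' y ∧ (𝔥 K k U₀).inv V y = (𝔥 K k U₀).inv V' y)
    (hderiv : ∀ Y : Set (Site (F.P K) 0), (∀ i, i < k → ∀ s : Site (F.P K) i, toFine i s ∈ Y ↔ toFine (i + 1) (blockOf s) ∈ Y) →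
      ∀ Z Z' : PBond (F.P K) 0 → Matrix (Fin N) (Fin N) ℂ, (∀ b : PBond (F.P K) 0, b ∈ bondsIn 0 Y → Z b = Z' b) →
      ∀ y : Site (F.P K) k, toFine k y ∈ Y → (𝔥 K k U₀).deriv Z y = (𝔥 K k U₀).deriv Z' y)
    (hH : Prop4LetterHPrAtRecord F N K k Ω U₀ (𝔥 K k U₀) levB a hpos hQ b)
    -- (KL-H)ᵖʳ
    {hk : Bond (F.P K).d (fun _ => (F.P K).sitesPerDir 0) → PBond (F.P K) k → ℝ} (hk0 : ∀ b' y, 0 ≤ hk b' y)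
    (hHk : ∀ (y : PBond (F.P K) k) (Z : Matrix (Fin N) (Fin N) ℂ) (b' : Bond (F.P K).d (fun _ => (F.P K).sitesPerDir 0)),
      ‖flat115 (H1prOfRecordAtBg F N K k Ω U₀ (𝔥 K k U₀) levB a hpos hQ
          ((NegSup.equiv (levWeight (F.L : ℝ) ((F.P K).eta k) levB 0) (Matrix (Fin N) (Fin N) ℂ)).symm (Pi.single y Z))) b'‖ ≤ hk b' y * ‖Z‖)
    {ΘH : ℝ} (hΘH : 0 ≤ ΘH) (hH1 : ∀ y, ∑ b', hk b' y ≤ ΘH) {ΘHw : ℝ} (hΘHw : 0 ≤ ΘHw)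
    (hHw : ∀ (bb : Bond (F.P K).d (fun _ => (F.P K).sitesPerDir 0)) (y : PBond (F.P K) k),
      ∑ b', levWeight (F.L : ℝ) ((F.P K).eta k) (bondLevLit F Ω k) 3 bb / levWeight (F.L : ℝ) ((F.P K).eta k) (bondLevLit F Ω k) 3 b' * hk b' y ≤ ΘHw)
    -- (KL-C)ᵖʳ := the (157) clause of `B7.Prop5Printed (kexpOfRecordPr F N 𝔥)` at `(α, α₁, C₃)`, `r + r ≤ α₁`, and the window
    {C₃ α₁ : ℝ} (hC₃ : 0 ≤ C₃)
    (h157 : ∀ (i : KRecIdx F) (U₀ : (kexpOfRecordPr F N 𝔥 i).Cfg), (kexpOfRecordPr F N 𝔥 i).plaqDevEta U₀ < α →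
      ∀ A : (kexpOfRecordPr F N 𝔥 i).Fld, (kexpOfRecordPr F N 𝔥 i).fldNorm A < α₁ → (kexpOfRecordPr F N 𝔥 i).dCk U₀ A ≤ C₃ * (kexpOfRecordPr F N 𝔥 i).fldNorm A)
    (hrα₁ : letI C₂ : ℝ := (6400000000000 * c𝔥 + 25600000000000000) * (F.L : ℝ) * N
      letI c₄ : ℝ := 1 / (200000000000 * (F.L : ℝ) * N)
      letI r : ℝ := min (c₄ / 4) (min (1 / 2) (1 / (16 * (b * C₂ + 1))))
      r + r ≤ α₁)
    (hq : letI C₂ : ℝ := (6400000000000 * c𝔥 + 25600000000000000) * (F.L : ℝ) * N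
      letI c₄ : ℝ := 1 / (200000000000 * (F.L : ℝ) * N)
      letI r : ℝ := min (c₄ / 4) (min (1 / 2) (1 / (16 * (b * C₂ + 1))))
      (r + r) * ΘH * (2 * ((F.P K).d : ℝ) * (C₃ * (F.P K).eta k ^ (F.P K).d)) ≤ 1 / 2)
    -- {W3} := the locality rows of the current reader `Δπ(U₀; G′, Q′)` ([B11] (72)–(73)∕(86)–(89)): (L) fine majorants `s₀, s₁`, (R) block-aggregated row decay — DISPLAYED
    {s0 : Bond (F.P K).d (fun _ => (F.P K).sitesPerDir 0) → Bond (F.P K).d (fun _ => (F.P K).sitesPerDir 0) → ℝ} {s1 : Bond (F.P K).d (fun _ => (F.P K).sitesPerDir 0) → Bond (F.P K).d (fun _ => (F.P K).sitesPerDir 0) × Fin (F.P K).d → ℝ} (hs0 : ∀ b' x, 0 ≤ s0 b' x) (hs1 : ∀ b' p, 0 ≤ s1 b' p)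
    (hS : ∀ (A : Space115Lit F N K k Ω U₀) (b' : Bond (F.P K).d (fun _ => (F.P K).sitesPerDir 0)),
      ‖NegSup.equiv (levWeight (F.L : ℝ) ((F.P K).eta k) (bondLevLit F Ω k) 3) (Matrix (Fin N) (Fin N) ℂ) (DeltaPiCurOfRecord F N K k Ω U₀ Gp (QprimeOfRecord F N k U₀) A) b'‖ ≤
        ∑ x : Bond (F.P K).d (fun _ => (F.P K).sitesPerDir 0), s0 b' x * ‖JetSup.equiv _ _ _ A x‖ +
        ∑ p : Bond (F.P K).d (fun _ => (F.P K).sitesPerDir 0) × Fin (F.P K).d, s1 b' p * ‖(nabla115 ((F.P K).eta k) (unitsOfRecord F N U₀)) (JetSup.equiv _ _ _ A) p‖)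
    {Cπ σ : ℝ} (hCπ : 0 ≤ Cπ) (hσ : 0 < σ)
    (hR : ∀ (b' : Bond (F.P K).d (fun _ => (F.P K).sitesPerDir 0)) (y'' : PBond (F.P K) k),
      blockRow0 F K k s0 b' y'' + blockRow1 F K k s1 b' y'' ≤
        Cπ * Real.exp (-(σ * (Site.tdist (blkOfBond F K k b').src y''.src : ℝ))))
    -- {W2} := the (3.133) entry rows of `H₁^{pr}(U₀)` at `(B₀, ρ)` ([B9] Thm 3.12; lane N07) — DISPLAYED
    {B₀ ρ : ℝ} (hB₀ : 0 ≤ B₀) (hρ : 0 < ρ)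
    (h0 : ∀ y'' y : PBond (F.P K) k, entry0 F N K k Ω U₀ levB (H1prOfRecordAtBg F N K k Ω U₀ (𝔥 K k U₀) levB a hpos hQ) y'' y ≤ B₀ * Real.exp (-(ρ * (Site.tdist y''.src y.src : ℝ))))
    (h1 : ∀ y'' y : PBond (F.P K) k, entry1 F N K k Ω U₀ levB (H1prOfRecordAtBg F N K k Ω U₀ (𝔥 K k U₀) levB a hpos hQ) y'' y ≤ B₀ * Real.exp (-(ρ * (Site.tdist y''.src y.src : ℝ))))
    (hJ : ‖JOfRecordAtBg F N K k Ω U₀‖ ≤ nJ) :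
    letI N₁ : ℝ := Cπ * B₀ * ((F.P K).d * (2 * (1 + 1 / (min σ ρ / 2))) ^ (F.P K).d) * ((F.P K).d * (2 * (1 + 1 / (min σ ρ / 2))) ^ (F.P K).d)
    letI Θ' : ℝ := ((((F.P K).L ^ (F.P K).d) ^ k : ℕ) : ℝ) * N₁
    letI C₂ : ℝ := (6400000000000 * c𝔥 + 25600000000000000) * (F.L : ℝ) * N
    letI c₄ : ℝ := 1 / (200000000000 * (F.L : ℝ) * N)
    letI r : ℝ := min (c₄ / 4) (min (1 / 2) (1 / (16 * (b * C₂ + 1))))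
    letI R' : ℝ := min r ((1 - 4 * b * C₂ * (r + r)) * (1 / 16))
    letI CV : ℝ := 1024 * (((F.P K).d - 1 : ℕ) : ℝ) * ((1 : ℝ) * 1) ^ 3 * N * (α * (1 : ℝ) ^ 2 + 1 / 16)
        + (((F.P K).d - 1 : ℕ) : ℝ) * ((1 : ℝ) * 1) ^ 3 * (136 + 2 * ((1 : ℝ) * 1)) * N
    letI G : ℝ := 2 * ((F.P K).d : ℝ) * (C₃ * (F.P K).eta k ^ (F.P K).d)
    letI θ₃ : ℝ := (2 * (1 / (1 - 4 * b * C₂ * (r + r))) + 1) * ΘHw * G / r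
    letI θE : ℝ := 2 * ΘHw * G * (1 / (1 - 4 * b * C₂ * (r + r)))
    letI θE' : ℝ := 2 * Θ' * G * (1 / (1 - 4 * b * C₂ * (r + r)))
    Prop4UniformPrAtRecord F N K k Ω U₀ (𝔥 K k U₀) levB a hpos hQ r Gp
      ((N * θ₃ * nJ + (N₁ * C₂ * (1 / (1 - 4 * b * C₂ * (r + r))) ^ 2 + N * θE')
        + N * θE * (N₁ * C₂ * (1 / (1 - 4 * b * C₂ * (r + r))) ^ 2) * R'
        + N * (1 + θE * R') * CV * (1 / (1 - 4 * b * C₂ * (r + r))) ^ 2)) R' := by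
  obtain ⟨hk'0, hNk, hΘ'0, hΘ', hN₁0, hN₁⟩ := klNPr_of_localityRows_of_entryBounds F N K k Ω U₀ levB (𝔥 K k U₀) a hpos hQ Gp hΩ hkm hs0 hs1 hS hCπ hσ hR hB₀ hρ h0 h1
  exact prop4UniformPrAtRecord_node00_of_prop5Clause_pr_param F N 𝔥 K k Ω U₀ levB a hpos hQ Gp hkpos hkm hb hΩ hαpos hα hreg hc0 hc hdom hnear hmap hderiv hH hk0 hHk hΘH hH1 hΘHw hHw hC₃ h157 hrα₁ hq
    hk'0 hNk hΘ'0 hΘ' hN₁0 hN₁ hJ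

/-- ★★★ **hand-KLC's §5 DOOR (datum family `𝔥`) WITH ALL THREE PROPAGATOR LETTER GROUPS DISCHARGED FROM ONE DISPLAYED (3.133) PAIR AND THE LOCALITY ROWS OF `Δπ`** —
(ℓa-H)ᵖʳ `hH` by ✓`prop4LetterHPrAtRecord_of_entryBounds` (`b := B₀ · d(2(1+1∕ρ))^d`), (KL-H)ᵖʳ by ✓`klH_of_entryBounds` (`hk := ‖colOp H₁^{pr} y b′‖`, `Θ_H = Θ_H^w := (L^d)^k · b`),
(KL-N)ᵖʳ by ▶ PT-A's ✓`klNPr_of_localityRows_of_entryBounds` (`N₁ := C_π B₀ d(2(1+1∕m))^d · d(2(1+1∕m))^d`, `Θ′ := (L^d)^k · N₁`, `m := min σ ρ ∕ 2`) — so the door's REMAINING displayed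
letters are exactly: `hpos`∕`hQ`, the frame debts (hdom)∕(hnear)∕(hmap)∕(hderiv) of the family, {W2} = the (3.133) rows `h0 ∕ h1` of `H₁^{pr}(U₀)` ([B9] Thm 3.12, lane N07), {W3} = the
locality rows `hS ∕ hR` of `Δπ(U₀; G′, Q′)` ([B11] (72)–(73)∕(86)–(89)), the (157) clause `h157` of `B7.Prop5Printed (kexpOfRecordPr F N 𝔥)` with `r + r ≤ α₁` and the window `hq` (now
at `Θ_H = (L^d)^k · b`), `‖J‖ ≤ nJ`, print's (14) `hreg`, `∀ x, x ∈ Ω_k`.  Glue BY NAME over landed theorems; {W2}∕{W3} INHABITED NOWHERE; nothing of [B7]∕[B9]∕[B11] proved; `Θ_H`, `Θ′`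
are NOT k-free (G1 pairs them with (KL-C)'s `G ~ η^d`).
[cite: Balaban1985Variational, Prop. 4 (97)–(98) pp.292–293, (45)–(46) p.285, (72)–(73) p.289, (86)–(89) p.291, (103) p.293, (130) p.298; Balaban1985Averaging, Proposition 5 (157) p.42; Balaban1985BackgroundPropagators, Thm 3.12 (3.126) p.420, (3.132)–(3.133) p.422; Balaban1984PropagatorsII, Lemma 2.1 (2.61) p.234] -/
theorem prop4UniformPrAtRecord_node00_of_prop5Clause_pr_param_of_entryRows (levB : PBond (F.P K) k → ℕ) (a : ℝ)
    (hpos : ∀ x, x ≠ 0 → 0 < RCLike.re ⟪x, laplaceAOfRecord F N k U₀ (QprOfRecord F N k U₀ (𝔥 K k U₀)) (QprimeOfRecord F N k U₀) a x⟫_ℂ)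
    (hQ : Function.Surjective (QprOfRecord F N k U₀ (𝔥 K k U₀)))
    (Gp : SiteL2K ℂ (F.P K).d (fun _ => (F.P K).sitesPerDir 0) (c0Rec F K k) (WRec N) →ₗ[ℂ]
      SiteL2K ℂ (F.P K).d (fun _ => (F.P K).sitesPerDir 0) (c0Rec F K k) (WRec N))
    {α nJ : ℝ} (hkpos : 0 < k) (hkm : k ≤ (F.P K).m + (F.P K).K) (hΩ : ∀ x, x ∈ Ω k) (hαpos : 0 < α) (hα : α * (11000000 * N) ≤ 1)
    (hreg : ∀ j, j < k → PlaqSmall (α * ((F.L : ℝ) ^ j * (F.P K).eta k) ^ 2) (Averaging.iter (avOfRecord F N K) j U₀))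
    {c𝔥 : ℝ} (hc0 : 0 ≤ c𝔥) (hc : c𝔥 ≤ 10000000000)
    (hdom : ∀ Y : PBond (F.P K) 0 → Matrix (Fin N) (Fin N) ℂ, (∀ b, (Y b).trace = 0) → (F.L : ℝ) ^ k * ‖Y‖ < 1 / (25000000000 * (F.L : ℝ) * N) →
      expOver U₀ Y ∈ (𝔥 K k U₀).dom)
    (hnear : ∀ Y : PBond (F.P K) 0 → Matrix (Fin N) (Fin N) ℂ, (∀ b, (Y b).trace = 0) → (F.L : ℝ) ^ k * ‖Y‖ < 1 / (25000000000 * (F.L : ℝ) * N) →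
      ∀ y : Site (F.P K) k, ‖(𝔥 K k U₀).map (expOver U₀ Y) y - 1‖ ≤ c𝔥 * ((F.L : ℝ) ^ k * ‖Y‖) ∧ ‖(𝔥 K k U₀).inv (expOver U₀ Y) y - 1‖ ≤ c𝔥 * ((F.L : ℝ) ^ k * ‖Y‖))
    (hmap : ∀ Y : Set (Site (F.P K) 0), (∀ i, i < k → ∀ s : Site (F.P K) i, toFine i s ∈ Y ↔ toFine (i + 1) (blockOf s) ∈ Y) →
      ∀ V V' : PBond (F.P K) 0 → Matrix (Fin N) (Fin N) ℂ, (∀ b : PBond (F.P K) 0, b ∈ bondsIn 0 Y → V b = V' b) →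
      ∀ y : Site (F.P K) k, toFine k y ∈ Y → (𝔥 K k U₀).map V y = (𝔥 K k U₀).map V' y ∧ (𝔥 K k U₀).inv V y = (𝔥 K k U₀).inv V' y)
    (hderiv : ∀ Y : Set (Site (F.P K) 0), (∀ i, i < k → ∀ s : Site (F.P K) i, toFine i s ∈ Y ↔ toFine (i + 1) (blockOf s) ∈ Y) →
      ∀ Z Z' : PBond (F.P K) 0 → Matrix (Fin N) (Fin N) ℂ, (∀ b : PBond (F.P K) 0, b ∈ bondsIn 0 Y → Z b = Z' b) →
      ∀ y : Site (F.P K) k, toFine k y ∈ Y → (𝔥 K k U₀).deriv Z y = (𝔥 K k U₀).deriv Z' y)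
    -- {W2} := the (3.133) entry rows of `H₁^{pr}(U₀)` at `(B₀, ρ)` ([B9] Thm 3.12; lane N07) — DISPLAYED
    {B₀ ρ : ℝ} (hB₀ : 0 ≤ B₀) (hρ : 0 < ρ)
    (h0 : ∀ y'' y : PBond (F.P K) k, entry0 F N K k Ω U₀ levB (H1prOfRecordAtBg F N K k Ω U₀ (𝔥 K k U₀) levB a hpos hQ) y'' y ≤ B₀ * Real.exp (-(ρ * (Site.tdist y''.src y.src : ℝ))))
    (h1 : ∀ y'' y : PBond (F.P K) k, entry1 F N K k Ω U₀ levB (H1prOfRecordAtBg F N K k Ω U₀ (𝔥 K k U₀) levB a hpos hQ) y'' y ≤ B₀ * Real.exp (-(ρ * (Site.tdist y''.src y.src : ℝ))))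
    -- (KL-C)ᵖʳ := the (157) clause of `B7.Prop5Printed (kexpOfRecordPr F N 𝔥)` at `(α, α₁, C₃)`, `r + r ≤ α₁`, and the window
    {C₃ α₁ : ℝ} (hC₃ : 0 ≤ C₃)
    (h157 : ∀ (i : KRecIdx F) (U₀ : (kexpOfRecordPr F N 𝔥 i).Cfg), (kexpOfRecordPr F N 𝔥 i).plaqDevEta U₀ < α →
      ∀ A : (kexpOfRecordPr F N 𝔥 i).Fld, (kexpOfRecordPr F N 𝔥 i).fldNorm A < α₁ → (kexpOfRecordPr F N 𝔥 i).dCk U₀ A ≤ C₃ * (kexpOfRecordPr F N 𝔥 i).fldNorm A)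
    (hrα₁ : letI b : ℝ := B₀ * ((F.P K).d * (2 * (1 + 1 / ρ)) ^ (F.P K).d)
      letI C₂ : ℝ := (6400000000000 * c𝔥 + 25600000000000000) * (F.L : ℝ) * N
      letI c₄ : ℝ := 1 / (200000000000 * (F.L : ℝ) * N)
      letI r : ℝ := min (c₄ / 4) (min (1 / 2) (1 / (16 * (b * C₂ + 1))))
      r + r ≤ α₁)
    (hq : letI b : ℝ := B₀ * ((F.P K).d * (2 * (1 + 1 / ρ)) ^ (F.P K).d)
      letI ΘH : ℝ := ((((F.P K).L ^ (F.P K).d) ^ k : ℕ) : ℝ) * b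
      letI C₂ : ℝ := (6400000000000 * c𝔥 + 25600000000000000) * (F.L : ℝ) * N
      letI c₄ : ℝ := 1 / (200000000000 * (F.L : ℝ) * N)
      letI r : ℝ := min (c₄ / 4) (min (1 / 2) (1 / (16 * (b * C₂ + 1))))
      (r + r) * ΘH * (2 * ((F.P K).d : ℝ) * (C₃ * (F.P K).eta k ^ (F.P K).d)) ≤ 1 / 2)
    -- {W3} := the locality rows of the current reader `Δπ(U₀; G′, Q′)` ([B11] (72)–(73)∕(86)–(89)): (L) fine majorants `s₀, s₁`, (R) block-aggregated row decay — DISPLAYED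
    {s0 : Bond (F.P K).d (fun _ => (F.P K).sitesPerDir 0) → Bond (F.P K).d (fun _ => (F.P K).sitesPerDir 0) → ℝ} {s1 : Bond (F.P K).d (fun _ => (F.P K).sitesPerDir 0) → Bond (F.P K).d (fun _ => (F.P K).sitesPerDir 0) × Fin (F.P K).d → ℝ} (hs0 : ∀ b' x, 0 ≤ s0 b' x) (hs1 : ∀ b' p, 0 ≤ s1 b' p)
    (hS : ∀ (A : Space115Lit F N K k Ω U₀) (b' : Bond (F.P K).d (fun _ => (F.P K).sitesPerDir 0)),
      ‖NegSup.equiv (levWeight (F.L : ℝ) ((F.P K).eta k) (bondLevLit F Ω k) 3) (Matrix (Fin N) (Fin N) ℂ) (DeltaPiCurOfRecord F N K k Ω U₀ Gp (QprimeOfRecord F N k U₀) A) b'‖ ≤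
        ∑ x : Bond (F.P K).d (fun _ => (F.P K).sitesPerDir 0), s0 b' x * ‖JetSup.equiv _ _ _ A x‖ +
        ∑ p : Bond (F.P K).d (fun _ => (F.P K).sitesPerDir 0) × Fin (F.P K).d, s1 b' p * ‖(nabla115 ((F.P K).eta k) (unitsOfRecord F N U₀)) (JetSup.equiv _ _ _ A) p‖)
    {Cπ σ : ℝ} (hCπ : 0 ≤ Cπ) (hσ : 0 < σ)
    (hR : ∀ (b' : Bond (F.P K).d (fun _ => (F.P K).sitesPerDir 0)) (y'' : PBond (F.P K) k),
      blockRow0 F K k s0 b' y'' + blockRow1 F K k s1 b' y'' ≤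
        Cπ * Real.exp (-(σ * (Site.tdist (blkOfBond F K k b').src y''.src : ℝ))))
    (hJ : ‖JOfRecordAtBg F N K k Ω U₀‖ ≤ nJ) :
    letI b : ℝ := B₀ * ((F.P K).d * (2 * (1 + 1 / ρ)) ^ (F.P K).d)
    letI ΘHw : ℝ := ((((F.P K).L ^ (F.P K).d) ^ k : ℕ) : ℝ) * b
    letI N₁ : ℝ := Cπ * B₀ * ((F.P K).d * (2 * (1 + 1 / (min σ ρ / 2))) ^ (F.P K).d) * ((F.P K).d * (2 * (1 + 1 / (min σ ρ / 2))) ^ (F.P K).d)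
    letI Θ' : ℝ := ((((F.P K).L ^ (F.P K).d) ^ k : ℕ) : ℝ) * N₁
    letI C₂ : ℝ := (6400000000000 * c𝔥 + 25600000000000000) * (F.L : ℝ) * N
    letI c₄ : ℝ := 1 / (200000000000 * (F.L : ℝ) * N)
    letI r : ℝ := min (c₄ / 4) (min (1 / 2) (1 / (16 * (b * C₂ + 1))))
    letI R' : ℝ := min r ((1 - 4 * b * C₂ * (r + r)) * (1 / 16))
    letI CV : ℝ := 1024 * (((F.P K).d - 1 : ℕ) : ℝ) * ((1 : ℝ) * 1) ^ 3 * N * (α * (1 : ℝ) ^ 2 + 1 / 16)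
        + (((F.P K).d - 1 : ℕ) : ℝ) * ((1 : ℝ) * 1) ^ 3 * (136 + 2 * ((1 : ℝ) * 1)) * N
    letI G : ℝ := 2 * ((F.P K).d : ℝ) * (C₃ * (F.P K).eta k ^ (F.P K).d)
    letI θ₃ : ℝ := (2 * (1 / (1 - 4 * b * C₂ * (r + r))) + 1) * ΘHw * G / r
    letI θE : ℝ := 2 * ΘHw * G * (1 / (1 - 4 * b * C₂ * (r + r)))
    letI θE' : ℝ := 2 * Θ' * G * (1 / (1 - 4 * b * C₂ * (r + r)))
    Prop4UniformPrAtRecord F N K k Ω U₀ (𝔥 K k U₀) levB a hpos hQ r Gp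
      ((N * θ₃ * nJ + (N₁ * C₂ * (1 / (1 - 4 * b * C₂ * (r + r))) ^ 2 + N * θE')
        + N * θE * (N₁ * C₂ * (1 / (1 - 4 * b * C₂ * (r + r))) ^ 2) * R'
        + N * (1 + θE * R') * CV * (1 / (1 - 4 * b * C₂ * (r + r))) ^ 2)) R' := by
  obtain ⟨hk0, hHk, hΘH, hH1, hHw⟩ := klH_of_entryBounds F N K k Ω U₀ levB (H1prOfRecordAtBg F N K k Ω U₀ (𝔥 K k U₀) levB a hpos hQ) hΩ hkm hB₀ hρ h0
  obtain ⟨hk'0, hNk, hΘ'0, hΘ', hN₁0, hN₁⟩ := klNPr_of_localityRows_of_entryBounds F N K k Ω U₀ levB (𝔥 K k U₀) a hpos hQ Gp hΩ hkm hs0 hs1 hS hCπ hσ hR hB₀ hρ h0 h1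
  exact prop4UniformPrAtRecord_node00_of_prop5Clause_pr_param F N 𝔥 K k Ω U₀ levB a hpos hQ Gp hkpos hkm (mul_nonneg hB₀ (by positivity)) hΩ hαpos hα hreg hc0 hc hdom hnear hmap hderiv 
    (prop4LetterHPrAtRecord_of_entryBounds F N K k Ω U₀ (𝔥 K k U₀) levB a hpos hQ hΩ hB₀ hρ h0 h1) hk0 hHk hΘH hH1 hΘH hHw hC₃ h157 hrα₁ hq hk'0 hNk hΘ'0 hΘ' hN₁0 hN₁ hJ

end Family

end Summit.QuantumFields.YangMills.Theorems.KExpOfRecordPr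

end
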